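import Summits.Ventures.PercRepro.GenQHyperplaneRowsA

/-!
# PercRepro — the flat-lattice counting rows, part A: the `j`-subsets of `G` by rank (night-4, gen 11)

Every `j`-subset of `G` has a rank `ρ ≤ q`: the rank-`q` ones are the spanning sets at level `n − j`
(`card_rank_q_subsets_eq_sum_Pc`), the rank-`ρ` ones (`ρ ≤ q − 1`) are the spanning `j`-subsets of the rank-`ρ` flats
(`h2_row` of `GenQHyperplaneRowsA`: `Σ_s SP^{(ρ)}_{s,j}`), and `SP^{(ρ)}_{s,j} ≤ C(s, j)·h^{(ρ)}_s` (H3).  So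

`C(n, j) = Σ_m #Pc (n−j) m + Σ_{ρ ≤ q−1} Σ_s SP^{(ρ)}_{s,j} ≤ Σ_m #Pc (n−j) m + Σ_s SP^{(q−1)}_{s,j} + Σ_{ρ ≤ q−2} Σ_s C(s,j)·h^{(ρ)}_s`

— the row (G-A) of the two-level profile LP (sheet §65 (b)) in its `≥` form (`ga_row`); the equality above the plane
bound needs the core's flat bounds and is not typed here.  Imports `GenQHyperplaneRowsA`.
-/
namespace PercRepro.Night4

open Finset ThmH SixFour GenQ PerFlat Star

variable {α : Type*} [DecidableEq α] {M : Matroid α} [M.Finite]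

omit [DecidableEq α] [M.Finite] in
/-- The `j`-subsets of `G` partitioned by rank: `C(n, j) = Σ_{ρ ≤ q} #{T ⊆ G : |T| = j, rk T = ρ}`. -/
theorem choose_eq_sum_card_rank_subsets {G : Finset α} {q : ℕ}
    (hrG : M.eRk (G : Set α) = (q : ℕ∞)) (j : ℕ) :
    G.card.choose j = ∑ ρ ∈ Finset.range (q + 1),
      ((G.powersetCard j).filter (fun T : Finset α => M.eRk (T : Set α) = (ρ : ℕ∞))).card := by
  classical
  rw [← Finset.card_powersetCard]
  refine Finset.card_eq_sum_card_fiberwise (f := fun T : Finset α => (M.eRk (T : Set α)).toNat)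
    (t := Finset.range (q + 1)) ?_ |>.trans (Finset.sum_congr rfl (fun ρ hρ => ?_))
  · intro T hT
    rw [Finset.mem_coe, Finset.mem_powersetCard] at hT
    rw [Finset.mem_coe, Finset.mem_range]
    obtain ⟨a, ha⟩ := exists_eRk_eq_nat (M := M) T
    have hle : M.eRk (T : Set α) ≤ (q : ℕ∞) := by
      rw [← hrG]
      exact M.eRk_mono (Finset.coe_subset.2 hT.1)
    change (M.eRk (T : Set α)).toNat < q + 1
    rw [ha] at hle ⊢
    have : a ≤ q := by exact_mod_cast hle
    rw [ENat.toNat_coe]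
    omega
  · congr 1
    ext T
    simp only [Finset.mem_filter, Finset.mem_powersetCard]
    constructor
    · rintro ⟨hT, hρ⟩
      refine ⟨hT, ?_⟩
      obtain ⟨a, ha⟩ := exists_eRk_eq_nat (M := M) T
      rw [ha] at hρ ⊢
      rw [ENat.toNat_coe] at hρ
      rw [hρ]
    · rintro ⟨hT, hρ⟩
      refine ⟨hT, ?_⟩
      rw [hρ, ENat.toNat_coe]

/-- The rank-`q` `j`-subsets of `G` are the spanning sets at level `n − j`: `#{…} = Σ_m #Pc (n−j) m` (`j ≤ n`). -/
theorem card_rank_q_subsets_eq_sum_Pc {G : Finset α} {q : ℕ} (hG : G ⊆ gr M)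
    (hrG : M.eRk (G : Set α) = (q : ℕ∞)) {j : ℕ} (hj : j ≤ G.card) :
    ((G.powersetCard j).filter (fun T : Finset α => M.eRk (T : Set α) = (q : ℕ∞))).card
      = ∑ m ∈ Finset.Icc (mTr M G) q, (Pc M G q (G.card - j) m).card := by
  classical
  have hset : (G.powersetCard j).filter (fun T : Finset α => M.eRk (T : Set α) = (q : ℕ∞))
      = levelSets M G q (G.card - j) := by
    ext T
    rw [Finset.mem_filter, Finset.mem_powersetCard, mem_levelSets, mem_Rq]
    constructor
    · rintro ⟨⟨hT, hTc⟩, hr⟩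
      refine ⟨⟨hT, hr⟩, ?_⟩
      rw [Finset.card_sdiff_of_subset hT, hTc]
    · rintro ⟨⟨hT, hr⟩, hk⟩
      refine ⟨⟨hT, ?_⟩, hr⟩
      have h1 := Finset.card_sdiff_of_subset hT
      have h2 := Finset.card_le_card hT
      omega
  rw [hset, Finset.card_eq_sum_card_fiberwise (f := fun S : Finset α => mTr M S) (t := Finset.Icc (mTr M G) q)]
  · refine Finset.sum_congr rfl (fun m _ => ?_)
    congr 1
    ext S
    rw [Finset.mem_filter, mem_levelSets, mem_Pc]
    tauto
  · intro S hS
    rw [Finset.mem_coe, mem_levelSets] at hS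
    rw [Finset.mem_coe, Finset.mem_Icc]
    have hSR := mem_Rq.1 hS.1
    exact ⟨mTr_le_of_mem_Rq hG hrG hS.1, mTr_le_of_eRk_eq (hSR.1.trans hG) hSR.2⟩

/-- **(G-A)**, the `≥` form: `C(n, j) ≤ Σ_m #Pc (n−j) m + Σ_s SP^{(q−1)}_{s,j} + Σ_{ρ ≤ q−2} Σ_s C(s, j)·h^{(ρ)}_s`
(`1 ≤ q`, `j ≤ n`). -/
theorem ga_row {G : Finset α} {q : ℕ} (hG : G ⊆ gr M) (hrG : M.eRk (G : Set α) = (q : ℕ∞)) (hq : 1 ≤ q)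
    {j : ℕ} (hj : j ≤ G.card) :
    G.card.choose j ≤ ∑ m ∈ Finset.Icc (mTr M G) q, (Pc M G q (G.card - j) m).card
      + ∑ s ∈ Finset.range (G.card + 1), spSum M G (q - 1) s j
      + ∑ ρ ∈ Finset.range (q - 1), ∑ s ∈ Finset.range (G.card + 1), s.choose j * hypTr M G ρ s := by
  classical
  rw [choose_eq_sum_card_rank_subsets hrG j]
  -- split off `ρ = q` and `ρ = q − 1`
  have hsplit : ∑ ρ ∈ Finset.range (q + 1),
      ((G.powersetCard j).filter (fun T : Finset α => M.eRk (T : Set α) = (ρ : ℕ∞))).card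
      = (∑ ρ ∈ Finset.range (q - 1),
          ((G.powersetCard j).filter (fun T : Finset α => M.eRk (T : Set α) = (ρ : ℕ∞))).card)
        + ((G.powersetCard j).filter (fun T : Finset α => M.eRk (T : Set α) = ((q - 1 : ℕ) : ℕ∞))).card
        + ((G.powersetCard j).filter (fun T : Finset α => M.eRk (T : Set α) = (q : ℕ∞))).card := by
    have h1 : q + 1 = (q - 1) + 1 + 1 := by omega
    rw [h1, Finset.sum_range_succ, Finset.sum_range_succ]
    have h2 : ((q - 1 + 1 : ℕ) : ℕ∞) = (q : ℕ∞) := by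
      have : q - 1 + 1 = q := by omega
      rw [this]
    simp only [h2]
  rw [hsplit, card_rank_q_subsets_eq_sum_Pc hG hrG hj, h2_row hG (q - 1) j]
  have hlow : ∑ ρ ∈ Finset.range (q - 1),
      ((G.powersetCard j).filter (fun T : Finset α => M.eRk (T : Set α) = (ρ : ℕ∞))).card
      ≤ ∑ ρ ∈ Finset.range (q - 1), ∑ s ∈ Finset.range (G.card + 1), s.choose j * hypTr M G ρ s := by
    refine Finset.sum_le_sum (fun ρ _ => ?_)
    rw [h2_row hG ρ j]
    exact Finset.sum_le_sum (fun s _ => spSum_le_choose_mul_hypTr G ρ s j)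
  omega

end PercRepro.Night4
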